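/-
Origin: expansion seat `planner-pub-hodgecm-pohl-g15-0`, handover #7 2026-08-18T16:19:39Z (md5 0d62f40e6d3fc15947293de9e53f5457, 233 l.; RUN-32 CANDIDATE ROW, ON REQUEST ONLY — TREE-SHAPE SPLIT (≤400 l.) of the pohl lineage, source lines verbatim; NEW first part; lands AFTER — (imports PKG DegreeZeroCrossModel); no import rewrite) (`HOME/pub-hodgecm-pohl-g15/lean/Pohl15/AnyCMFieldDictionary.lean`, md5 0d62f40e, 233 lines);
landed by the packager successor (mc-unitary-1-g3, gen-8 kit) in gate run 32 as `HodgeCM/Proofs/Pohlmann/AnyCMFieldDictionary.lean` (verbatim).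
-/
/-
Copyright: pub-hodgecm formalisation cell (harness21, 2026). New file (not vendored).
Origin: HOME/pub-hodgecm-pohl-g15/lean/Pohl15/AnyCMFieldDictionary.lean — session planner-pub-hodgecm-pohl-g15-0 (unit pub-hodgecm-pohl-g15),
EXPANSION part (b) `PohlmannSpan`, generation 15: TREE-SHAPE STAGING under the 400-line rule of lean/CONVENTIONS.md §2 — part 1/3
of the split of `HodgeCM/Proofs/Pohlmann/AnyCMField.lean` (pohl-g9, gate run 26; 723 l., md5 9785dda4ddb5): source lines 79–283 VERBATIM; the module docstring below is new (it only describes the cut).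
Intended final place: `HodgeCM/Proofs/Pohlmann/AnyCMFieldDictionary.lean` (module `HodgeCM.Proofs.Pohlmann.AnyCMFieldDictionary`); imports final (certified package modules only).
-/
import Summits.HodgeConjecture.HodgeCM.Proofs.Pohlmann.DegreeZeroCrossModel

/-!
# Pohlmann's theorem for an arbitrary CM field, I: the Galois-closure dictionary and the eigencharacter `λ(S) ∈ E^c`

First part of the former `AnyCMField.lean` (pohl-g9), split at its section boundaries under the tree's 400-line rule
(lean/CONVENTIONS.md §2); every declaration below is the source's, verbatim.  Contents: `section Dictionary` — Hodge weights
read through `Gal(E^c/ℚ)`, `E = F^{n+1}`, i.e. the source's condition (3.2) of Gao–Ullmo, *J. Inst. Math. Jussieu* **25** (2025)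
Thm 3.1 "(Pohlmann)", for ANY number field `F` (`IsHodgeWeightC`, the Galois-closure vocabulary under `namespace GaoUllmo`,
roots of rational polynomials under `ℚ`-algebra maps); `section Closure` — the eigencharacter `λ(S)` of the separating operator as
an element `λ^c(S)` of `E^c` and its Galois conjugates.  Both inclusions of the theorem, the print statements
(`PohlmannBasisCM`, `PohlmannSpanCM`) and their proofs are in `AnyCMFieldInclusions.lean`; the basis / dimension statements and the
cross-model identity are in `AnyCMField.lean` (which keeps the module name); each imports the previous part.
-/

noncomputable section

open scoped TensorProduct NumberField BigOperators
open Polynomial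

namespace HodgeCM

open Literature.AlgebraicGeometry.Motives (CMType HodgeStructure)
open Literature.AlgebraicGeometry.Motives.HodgeStructure (ofRat ofRat_apply)
open HodgeCM.Pohlmann HodgeCM.GaoUllmo HodgeCM.CMTypeOps

attribute [local instance] Classical.propDecidable

/-! ### Hodge weights through `Gal(E^c/ℚ)`, `E = F^{n+1}` — the source's condition (3.2), for any number field `F` -/

section Dictionary

variable {F : Type} [Field F] [NumberField F] {n : ℕ}

/-- **Hodge weights, Galois-closure form** (Gao–Ullmo Thm 3.1 / (3.2) read literally for `E = F^{n+1}`): `Σ_j |S_j| = 2p`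
and, for every `σ ∈ Gal(E^c/ℚ)` acting on `Hom(F, ℂ)` by `s ↦ σ ∘ s` (`GaoUllmo.galF`), `#{(j, s) : s ∈ S_j, σ ∘ s ∈ Θ_j} = p`.
For `F` Galois this is `IsHodgeWeight Θ p S` (`isHodgeWeight_iff_isHodgeWeightC`); in general it is implied by it. -/
def IsHodgeWeightC (Θ : Fin (n + 1) → CMType F) (p : ℕ) (S : Fin (n + 1) → Finset (F →+* ℂ)) : Prop :=
  (∑ j, (S j).card) = 2 * p ∧
    ∀ σ : galoisClosure (Fin (n + 1) → F) ≃ₐ[ℚ] galoisClosure (Fin (n + 1) → F),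
      (∑ j, ∑ s ∈ S j, ind (Θ j) (galF n σ s)) = (p : ℤ)

/-- A Hodge weight in the package's sense (all Galois translates `GalT F`) is one in the Galois-closure sense (any `F`). -/
theorem IsHodgeWeight.isHodgeWeightC {Θ : Fin (n + 1) → CMType F} {p : ℕ} {S : Fin (n + 1) → Finset (F →+* ℂ)}
    (hS : IsHodgeWeight Θ p S) : IsHodgeWeightC Θ p S :=
  ⟨hS.1, fun σ => by simpa only [galTOf_apply] using hS.2 (galTOf σ)⟩

/-- For `F` Galois over `ℚ` the two notions agree (every Galois translate comes from `Gal(E^c/ℚ)`, `galTOf_surjective`). -/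
theorem isHodgeWeight_iff_isHodgeWeightC [IsGalois ℚ F] (Θ : Fin (n + 1) → CMType F) (p : ℕ)
    (S : Fin (n + 1) → Finset (F →+* ℂ)) : IsHodgeWeight Θ p S ↔ IsHodgeWeightC Θ p S := by
  refine ⟨IsHodgeWeight.isHodgeWeightC, fun hS => ⟨hS.1, fun P => ?_⟩⟩
  obtain ⟨σ, rfl⟩ := galTOf_surjective (n := n) P
  simpa only [galTOf_apply] using hS.2 σ

namespace GaoUllmo

/-- `1 ∈ Gal(E^c/ℚ)` acts trivially on `Hom(F, ℂ)`. -/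
@[simp] theorem galF_one (s : F →+* ℂ) : galF n 1 s = s :=
  RingHom.ext fun _ => rfl

/-- `Gal(E^c/ℚ)` ACTS on `Hom(F, ℂ)`: `(σ'σ) ∘ s = σ' ∘ (σ ∘ s)`. -/
theorem galF_mul (σ' σ : galoisClosure (Fin (n + 1) → F) ≃ₐ[ℚ] galoisClosure (Fin (n + 1) → F)) (s : F →+* ℂ) :
    galF n (σ' * σ) s = galF n σ' (galF n σ s) := by
  refine RingHom.ext fun a => ?_
  rw [galF_apply, galF_apply, AlgEquiv.mul_apply]
  congr 2

/-- **The dictionary, for ANY number field `F`** (compare `isHodgeWeight_iff_satisfiesEq32`, Galois `F` only):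
`IsHodgeWeightC Θ p S` IS Gao–Ullmo's `|P_S| = 2p ∧ (3.2)` for `P_S ⊆ Hom(F^{n+1}, ℂ)` and `Φ_Θ = ⊔_j Θ_j`. -/
theorem isHodgeWeightC_iff_satisfiesEq32 (Θ : Fin (n + 1) → CMType F) (p : ℕ) (S : Fin (n + 1) → Finset (F →+* ℂ)) :
    IsHodgeWeightC Θ p S ↔ (embSet S).card = 2 * p ∧ SatisfiesEq32 (piCMType Θ) (embSet S) := by
  rw [IsHodgeWeightC, card_embSet]
  refine and_congr_right fun hcard => forall_congr' fun σ => ?_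
  have hsum := card_galActSet_inter_bar σ (piCMType Θ) (embSet S)
  rw [card_galActSet_embSet_inter, card_embSet, hcard] at hsum
  rw [sum_ind_eq_typeCount, card_galActSet_embSet_inter]
  constructor
  · intro h
    have h' : typeCount Θ S (galF n σ) = p := by exact_mod_cast h
    omega
  · intro h
    have h' : typeCount Θ S (galF n σ) = p := by omega
    exact_mod_cast h'

/-- The bijection of index sets, any `F`: `{S // IsHodgeWeightC Θ p S} ≃ {P ⊆ Hom(F^{n+1}, ℂ), |P| = 2p // (3.2)}`. -/
def hodgeWeightCEquiv (Θ : Fin (n + 1) → CMType F) (p : ℕ) :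
    {S : Fin (n + 1) → Finset (F →+* ℂ) // IsHodgeWeightC Θ p S} ≃
      {P : Set.powersetCard (Emb (Fin (n + 1) → F)) (2 * p) //
        SatisfiesEq32 (piCMType Θ) (P : Finset (Emb (Fin (n + 1) → F)))} where
  toFun S := ⟨⟨embSet S.1, ((isHodgeWeightC_iff_satisfiesEq32 Θ p S.1).mp S.2).1⟩,
    ((isHodgeWeightC_iff_satisfiesEq32 Θ p S.1).mp S.2).2⟩
  invFun P := ⟨weightOfSet (P.1 : Finset (Emb (Fin (n + 1) → F))), by
    rw [isHodgeWeightC_iff_satisfiesEq32, embSet_weightOfSet]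
    exact ⟨P.1.2, P.2⟩⟩
  left_inv S := Subtype.ext (weightOfSet_embSet S.1)
  right_inv P := Subtype.ext (Subtype.ext (embSet_weightOfSet (P.1 : Finset (Emb (Fin (n + 1) → F)))))

/-- The two counts agree, any `F`: `#{S // IsHodgeWeightC Θ p S} = #{P ⊆ Hom(F^{n+1}, ℂ) : |P| = 2p, (3.2)}`. -/
theorem card_hodgeWeightC_eq (Θ : Fin (n + 1) → CMType F) (p : ℕ) :
    Nat.card {S : Fin (n + 1) → Finset (F →+* ℂ) // IsHodgeWeightC Θ p S} =
      Nat.card {P : Set.powersetCard (Emb (Fin (n + 1) → F)) (2 * p) //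
        SatisfiesEq32 (piCMType Θ) (P : Finset (Emb (Fin (n + 1) → F)))} :=
  Nat.card_congr (hodgeWeightCEquiv Θ p)

/-- **Gao–Ullmo Thm 3.1 "In particular" in package vocabulary, ANY CM field `F`** (kernel, from `Theorem31_finrank_holds`):
in Gao–Ullmo's model of `A_{(F^{n+1}, ⊔_j Θ_j)} = ∏_j A_{(F, Θ_j)}`, `dim_ℚ B^p = #{S // IsHodgeWeightC Θ p S}`. -/
theorem finrank_Bp_pi_eq_card_hodgeWeightC [NumberField.IsCMField F] [LinearOrder (Emb (Fin (n + 1) → F))]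
    (Θ : Fin (n + 1) → CMType F) (hord : OrderConvention (piCMType Θ)) (p : ℕ) :
    Module.finrank ℚ (Bp (piCMType Θ) p) =
      Nat.card {S : Fin (n + 1) → Finset (F →+* ℂ) // IsHodgeWeightC Θ p S} := by
  rw [Theorem31_finrank_holds (Fin (n + 1) → F) (isCMAlgebra_pi (Fin (n + 1)) F) (piCMType Θ) hord p,
    card_hodgeWeightC_eq]

end GaoUllmo

/-- For a Galois-closure Hodge weight `S` (degree `2p`), `p_S = q_S = p`. -/
theorem types_of_isHodgeWeightC {Θ : Fin (n + 1) → CMType F} {p : ℕ} {S : Fin (n + 1) → Finset (F →+* ℂ)}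
    (hS : IsHodgeWeightC Θ p S) :
    (∑ j, ∑ s ∈ S j, ind (Θ j) s) = p ∧ (∑ j, ∑ s ∈ S j, (1 - ind (Θ j) s)) = p := by
  have hp : (∑ j, ∑ s ∈ S j, ind (Θ j) s) = p := by simpa only [galF_one] using hS.2 1
  refine ⟨hp, ?_⟩
  have hsum : (∑ j, ∑ s ∈ S j, ind (Θ j) s) + (∑ j, ∑ s ∈ S j, (1 - ind (Θ j) s)) =
      ((∑ j, (S j).card : ℕ) : ℤ) := by
    rw [← Finset.sum_add_distrib, Nat.cast_sum]
    refine Finset.sum_congr rfl fun j _ => ?_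
    rw [← Finset.sum_add_distrib, Finset.sum_congr rfl fun s _ => add_sub_cancel (ind (Θ j) s) 1]
    simp
  rw [hp, hS.1] at hsum
  push_cast at hsum
  linarith

/-- Roots, in an intermediate field `K ⊂ ℂ`, of a RATIONAL polynomial are carried to roots by every embedding `ψ : K → ℂ`. -/
theorem isRoot_algHom_of_isRoot (χ : ℚ[X]) {K : IntermediateField ℚ ℂ} (ψ : K →ₐ[ℚ] ℂ) {y : K}
    (h : (χ.map (algebraMap ℚ ℂ)).IsRoot (y : ℂ)) : (χ.map (algebraMap ℚ ℂ)).IsRoot (ψ y) := by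
  rw [IsRoot.def, eval_map, ← aeval_def] at h ⊢
  have hy : aeval y χ = 0 := by
    have h' : algebraMap K ℂ (aeval y χ) = 0 := by rw [← aeval_algebraMap_apply]; exact h
    exact (map_eq_zero_iff _ (algebraMap K ℂ).injective).mp h'
  rw [aeval_algHom_apply, hy, map_zero]

end Dictionary

namespace Universe

variable {U : Universe}

/-! ### The eigencharacter `λ(S)` as an element of `E^c`, and its Galois conjugates -/

section Closure

variable {F : CMField} {n : ℕ} {Θ : Fin (n + 1) → CMType F} {ι : Type} [Fintype ι]

/-- The eigencharacter `λ(S) = Σ_i c_i ∏_{s ∈ S_{j_i}} s(a_i)` of the separating operator (`sepVal`) as an element `λ^c(S)`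
of the Galois closure `E^c ⊂ ℂ` of `E = F^{n+1}`: each `s(a_i) = (s ∘ pr₀)(diag a_i)` lies in `E^c`. -/
def sepValC (j : ι → Fin (n + 1)) (a : ι → 𝓞 F) (c : ι → ℕ) (S : Fin (n + 1) → Finset ((F : Type) →+* ℂ)) :
    galoisClosure (Fin (n + 1) → (F : Type)) :=
  ∑ i, (c i : galoisClosure (Fin (n + 1) → (F : Type))) *
    ∏ s ∈ S (j i), corestrict (Fin (n + 1) → (F : Type)) (piEmb 0 s) (piDiag (a i : F))

/-- (Ported verbatim from the HodgeCMPerL package; no docstring in the source.) -/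
theorem algHom_sepValC (ψ : galoisClosure (Fin (n + 1) → (F : Type)) →ₐ[ℚ] ℂ) (j : ι → Fin (n + 1)) (a : ι → 𝓞 F)
    (c : ι → ℕ) (S : Fin (n + 1) → Finset ((F : Type) →+* ℂ)) :
    ψ (sepValC j a c S) =
      ∑ i, (c i : ℂ) * ∏ s ∈ S (j i), ψ (corestrict (Fin (n + 1) → (F : Type)) (piEmb 0 s) (piDiag (a i : F))) := by
  simp only [sepValC, map_sum, map_mul, map_natCast, map_prod]

/-- `λ^c(S) = λ(S)` in `ℂ`. -/
theorem coe_sepValC (j : ι → Fin (n + 1)) (a : ι → 𝓞 F) (c : ι → ℕ) (S : Fin (n + 1) → Finset ((F : Type) →+* ℂ)) :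
    ((sepValC j a c S : galoisClosure (Fin (n + 1) → (F : Type))) : ℂ) = sepVal j a c S :=
  (algHom_sepValC (galoisClosure (Fin (n + 1) → (F : Type))).val j a c S).trans
    (Finset.sum_congr rfl fun _ _ => rfl)

/-- `σ(λ^c(S)) = λ(σ · S)` for `σ ∈ Gal(E^c/ℚ)` acting on weights through `galTOf σ` (`(σ · S)_j = {σ ∘ s : s ∈ S_j}`). -/
theorem coe_gal_sepValC (σ : galoisClosure (Fin (n + 1) → (F : Type)) ≃ₐ[ℚ] galoisClosure (Fin (n + 1) → (F : Type)))
    (j : ι → Fin (n + 1)) (a : ι → 𝓞 F) (c : ι → ℕ) (S : Fin (n + 1) → Finset ((F : Type) →+* ℂ)) :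
    ((σ (sepValC j a c S) : galoisClosure (Fin (n + 1) → (F : Type))) : ℂ) = sepVal j a c (permWeight (galTOf σ).1 S) := by
  have h : ((σ (sepValC j a c S) : galoisClosure (Fin (n + 1) → (F : Type))) : ℂ) =
      ((galoisClosure (Fin (n + 1) → (F : Type))).val.comp
        (σ : galoisClosure (Fin (n + 1) → (F : Type)) →ₐ[ℚ] galoisClosure (Fin (n + 1) → (F : Type))))
        (sepValC j a c S) := rfl
  rw [h, algHom_sepValC, sepVal]
  refine Finset.sum_congr rfl fun i _ => ?_
  rw [prod_permWeight]
  rfl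

/-- `ψ(λ^c(S)) = λ(σ_ψ · S)` for an embedding `ψ : E^c → ℂ` and the automorphism `σ_ψ = autOfEmb ψ ∈ Gal(E^c/ℚ)` it defines. -/
theorem algHom_sepValC_eq (ψ : galoisClosure (Fin (n + 1) → (F : Type)) →ₐ[ℚ] ℂ) (j : ι → Fin (n + 1)) (a : ι → 𝓞 F)
    (c : ι → ℕ) (S : Fin (n + 1) → Finset ((F : Type) →+* ℂ)) :
    ψ (sepValC j a c S) = sepVal j a c (permWeight (galTOf (autOfEmb ψ)).1 S) := by
  rw [← coe_gal_sepValC]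
  rfl

/-- `λ(S) = λ^c(S) ∈ E^c`, `λ(σ · S) = σ(λ^c(S))` for `σ ∈ Gal(E^c/ℚ)`, and `λ(σ_ψ · S) = ψ(λ^c(S))` for `ψ : E^c → ℂ`
(the Galois-closure replacement of `exists_sepVal_eq_emb`, which needs `F` Galois). -/
theorem exists_sepVal_eq_closure (j : ι → Fin (n + 1)) (a : ι → 𝓞 F) (c : ι → ℕ)
    (S : Fin (n + 1) → Finset ((F : Type) →+* ℂ)) :
    ∃ y : galoisClosure (Fin (n + 1) → (F : Type)), sepVal j a c S = y ∧
      (∀ σ : galoisClosure (Fin (n + 1) → (F : Type)) ≃ₐ[ℚ] galoisClosure (Fin (n + 1) → (F : Type)),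
        sepVal j a c (permWeight (galTOf σ).1 S) = σ y) ∧
      ∀ ψ : galoisClosure (Fin (n + 1) → (F : Type)) →ₐ[ℚ] ℂ,
        sepVal j a c (permWeight (galTOf (autOfEmb ψ)).1 S) = ψ y :=
  ⟨sepValC j a c S, (coe_sepValC j a c S).symm, fun σ => (coe_gal_sepValC σ j a c S).symm,
    fun ψ => (algHom_sepValC_eq ψ j a c S).symm⟩

/-- A `Gal(E^c/ℚ)`-translate of a Galois-closure Hodge weight is one. -/
theorem isHodgeWeightC_permWeight {p : ℕ} {S : Fin (n + 1) → Finset ((F : Type) →+* ℂ)} (hS : IsHodgeWeightC Θ p S)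
    (σ : galoisClosure (Fin (n + 1) → (F : Type)) ≃ₐ[ℚ] galoisClosure (Fin (n + 1) → (F : Type))) :
    IsHodgeWeightC Θ p (permWeight (galTOf σ).1 S) := by
  refine ⟨by rw [sum_card_permWeight]; exact hS.1, fun σ' => ?_⟩
  rw [sum_sum_permWeight (galTOf σ).1 S fun j t => ind (Θ j) (galF n σ' t)]
  simpa only [galF_mul, galTOf_apply] using hS.2 (σ' * σ)

/-- The weight space of a Galois-closure Hodge weight lies in `H^{p,p}` (M30). -/
theorem weightSpace_le_piece_of_isHodgeWeightC (h30 : U.Fact_weightHodge) {p : ℕ}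
    {S : Fin (n + 1) → Finset ((F : Type) →+* ℂ)} (hS : IsHodgeWeightC Θ p S) :
    U.weightSpace F Θ S (2 * p) ≤ (U.hodge (U.cmProd F Θ) (2 * p)).piece p p := by
  have h := h30 F n Θ (2 * p) S
  obtain ⟨hp, hq⟩ := types_of_isHodgeWeightC hS
  rwa [hp, hq] at h

end Closure

end Universe

end HodgeCM

end
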